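import Literature.Analysis.FluidPDE.ClassicalSuitable
import Literature.Analysis.FluidPDE.LocalTypeI
import HarnessLib

/-!
# The parasitic slab flow `u = b(t) e₀`: a suitable weak solution with the Type-I rate, a fully
# singular final slice and `𝐈 = ∞` (KNSS 2009, §1)

Analysis/FluidPDE proofs-layer file (theorems + four data definitions, no new `Prop` facts) over
the accepted `IsSuitableWeakSolutionOn`, `HasWeakSpatialGradientOn` (`SuitableWeak.lean`),
`HasTypeITimeDecay` / `HasTypeIDecay` / `nsRescale` (`SelfSimilar.lean`) and Albritton–Barker's
`typeIBound`, `cknAEss`, `IsBackwardSingularPoint` (`LocalTypeI.lean`).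

Koch–Nadirashvili–Seregin–Šverák 2009 (Acta Math. 203), §1 p. 3: the Navier–Stokes system on a
slab admits the "parasitic solutions" `u(x,t) = b(t)`, `p(x,t) = −b′(t)·x`, which is why bounded
ancient (mild) solutions are defined through the duality / weak formulation, and why
Albritton–Barker 2019 §1 work with `𝐈 < ∞` ("`v ≡ const.` and `𝐈 < ∞` imply `v ≡ 0`"; tree
`LocalTypeI.lean`, design notes: "the parasitic `u = b(t)` … have `𝐈 = ∞` unless `b = 0` a.e.,
since `A(Q(z, r)) ~ r² |b|²`"). This file makes the remark a theorem for the SCALE-INVARIANT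
amplitude `b_C(t) = C/√(−t)`, the one relevant to Type-I classes:

* `parasiticVelocity C`, `parasiticPressure C` — `u(t,x) = (C/√(−t)) e₀`, `p(t,x) = ⟨−b_C′(t) e₀, x⟩`;
* `parasitic_isSuitableWeakSolutionOn` — `(u, p)` is a suitable weak solution of Navier–Stokes
  (`ν = 1`, `f = 0`) on the backward slab `(-∞, 0) × ℝ³` (it is a `C²`/`C¹` classical solution
  there; tree `isSuitableWeakSolutionOn_of_contDiffOn`), with weak spatial gradient
  (`parasitic_hasWeakSpatialGradientOn`);
* `parasitic_hasTypeITimeDecay` — it SATURATES the Type-I rate `‖u‖ ≤ C/√(−t)` (KNSS (1.4));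
* `parasitic_isBackwardSingularPoint` — it is backward-singular (A–B §1, `ess sup = ∞` on every
  `Q((0,x₀), r)`) at EVERY final-time point `(0, x₀)`;
* `parasitic_not_hasTypeIDecay` — it admits NO space–time Type-I bound `C'/(‖x‖ + √(−t))`
  (KNSS (1.6)); `parasitic_nsRescale` — it is exactly backward self-similar;
* `parasitic_cknAEss_eq_top`, `parasitic_typeIBound_eq_top` — `A(Q(0, r)) = ∞`, hence
  `𝐈(ℝ³ × ℝ₋) = ∞` for EVERY pressure and gradient candidate;
* contrast lemma `not_isBackwardSingularPoint_of_hasTypeIDecay` — under the space–time bound no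
  final-time point off the origin is singular (the final-time singular set sits in `{0}`);
* `not_rate_imp_spaceTime_of_suitable_singular` — consequently it is FALSE that a suitable weak
  solution on the slab with the Type-I rate and a singular origin admits a space–time Type-I bound
  (the hypothesis `𝐈 < ∞` of the Type-I profile classes is load-bearing).

Used by the disprover of route item `ApexLocalisation` (stmt-NavierStokesRegularity-11719,
route RellichScar) to certify which antecedent hypotheses any proof must use.

## References

* G. Koch, N. Nadirashvili, G. Seregin, V. Šverák, *Liouville theorems for the Navier–Stokes
  equations and applications*, Acta Math. 203 (2009) 83–105, §1 (parasitic solutions; (1.4),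
  (1.6)) [KNSS2009].
* D. Albritton, T. Barker, *On local Type I singularities of the Navier–Stokes equations and
  Liouville theorems*, J. Math. Fluid Mech. 21 (2019), §1 (`A`, `𝐈`, singular points)
  [AlbrittonBarker2019].
* L. Caffarelli, R. Kohn, L. Nirenberg, CPAM 35 (1982), §2 ("if `u` is smooth, (2.5) holds with
  equality") [CaffarelliKohnNirenberg1982].
-/

noncomputable section

open MeasureTheory TopologicalSpace Set Function Filter Topology Metric
open scoped InnerProductSpace RealInnerProductSpace ENNReal NNReal Laplacian

namespace Literature.Analysis.FluidPDE

/-- Local notation for physical space `ℝ³ = EuclideanSpace ℝ (Fin 3)`. -/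
local notation "ℝ³" => EuclideanSpace ℝ (Fin 3)

/-- Local notation for the open backward slab `(-∞, 0) × ℝ³` (time first). -/
local notation "𝕊" => slab (EuclideanSpace ℝ (Fin 3)) (Iio (0 : ℝ)) isOpen_Iio

/-! ## The parasitic flow -/

/-- The direction `e₀ = (1, 0, 0) ∈ ℝ³` of the parasitic flow. [folklore] -/
def parasiticDir : ℝ³ := EuclideanSpace.single 0 1

/-- `‖e₀‖ = 1`. [folklore] -/
theorem norm_parasiticDir : ‖parasiticDir‖ = 1 := by
  simp [parasiticDir]

/-- `‖e₀‖ₑ = 1`. [folklore] -/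
theorem enorm_parasiticDir : ‖parasiticDir‖ₑ = 1 := by
  rw [← ofReal_norm, norm_parasiticDir, ENNReal.ofReal_one]

/-- The scale-invariant amplitude `b_C(t) = C / √(−t)` (KNSS 2009, §1: parasitic `b(t)`).
[cite: KNSS2009, §1] -/
def parasiticAmp (C t : ℝ) : ℝ := C / Real.sqrt (-t)

/-- `b_C ≥ 0` for `C ≥ 0`. [folklore] -/
theorem parasiticAmp_nonneg {C : ℝ} (hC : 0 ≤ C) (t : ℝ) : 0 ≤ parasiticAmp C t :=
  div_nonneg hC (Real.sqrt_nonneg _)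

/-- `b_C` is smooth on `t < 0`. [folklore] -/
theorem contDiffAt_parasiticAmp (C : ℝ) {t : ℝ} (ht : t < 0) {n : WithTop ℕ∞} :
    ContDiffAt ℝ n (parasiticAmp C) t := by
  have h1 : ContDiffAt ℝ n (fun s : ℝ => Real.sqrt (-s)) t :=
    (Real.contDiffAt_sqrt (by linarith : -t ≠ 0)).comp t contDiffAt_id.neg
  exact contDiffAt_const.div h1 (Real.sqrt_pos.2 (by linarith)).ne'

/-- `b_C ∈ C^n((-∞, 0))`. [folklore] -/
theorem contDiffOn_parasiticAmp (C : ℝ) {n : WithTop ℕ∞} : ContDiffOn ℝ n (parasiticAmp C) (Iio 0) :=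
  fun _ ht => (contDiffAt_parasiticAmp C ht).contDiffWithinAt

/-- `b_C` is differentiable on `t < 0`. [folklore] -/
theorem differentiableAt_parasiticAmp (C : ℝ) {t : ℝ} (ht : t < 0) : DifferentiableAt ℝ (parasiticAmp C) t :=
  (contDiffAt_parasiticAmp C ht (n := 1)).differentiableAt one_ne_zero

/-- The parasitic velocity `u(t, x) = b_C(t) e₀` (spatially constant; KNSS 2009, §1 p. 3).
[cite: KNSS2009, §1] -/
def parasiticVelocity (C : ℝ) : ℝ → ℝ³ → ℝ³ := fun t _ => parasiticAmp C t • parasiticDir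

/-- The parasitic pressure `p(t, x) = ⟨−b_C′(t) e₀, x⟩` (linear in `x`; KNSS 2009, §1 p. 3).
[cite: KNSS2009, §1] -/
def parasiticPressure (C : ℝ) : ℝ → ℝ³ → ℝ := fun t x => ⟪(-deriv (parasiticAmp C) t) • parasiticDir, x⟫

/-- `‖u(t, x)‖ = C/√(−t)` for `C ≥ 0`. [folklore] -/
theorem norm_parasiticVelocity {C : ℝ} (hC : 0 ≤ C) (t : ℝ) (x : ℝ³) :
    ‖parasiticVelocity C t x‖ = C / Real.sqrt (-t) := by
  show ‖parasiticAmp C t • parasiticDir‖ = _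
  rw [norm_smul, norm_parasiticDir, mul_one, Real.norm_of_nonneg (parasiticAmp_nonneg hC t)]
  rfl

/-- The parasitic velocity is jointly smooth on `t < 0`. [folklore] -/
theorem contDiffOn_parasiticVelocity (C : ℝ) {n : WithTop ℕ∞} :
    ContDiffOn ℝ n (uncurry (parasiticVelocity C)) (Iio 0 ×ˢ univ) := by
  have h : ContDiffOn ℝ n (fun z : ℝ × ℝ³ => parasiticAmp C z.1) (Iio 0 ×ˢ univ) :=
    (contDiffOn_parasiticAmp C).comp contDiffOn_fst fun z hz => hz.1
  exact h.smul contDiffOn_const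

/-- The parasitic pressure is jointly `C¹` on `t < 0`. [folklore] -/
theorem contDiffOn_parasiticPressure (C : ℝ) :
    ContDiffOn ℝ 1 (uncurry (parasiticPressure C)) (Iio 0 ×ˢ univ) := by
  have h1 : ContDiffOn ℝ 1 (deriv (parasiticAmp C)) (Iio 0) :=
    (contDiffOn_parasiticAmp C (n := 1 + 1)).deriv_of_isOpen isOpen_Iio le_rfl
  have h2 : ContDiffOn ℝ 1 (fun z : ℝ × ℝ³ => (-deriv (parasiticAmp C) z.1) • parasiticDir) (Iio 0 ×ˢ univ) :=
    ((h1.comp contDiffOn_fst fun z hz => hz.1).neg).smul contDiffOn_const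
  exact h2.inner ℝ contDiffOn_snd

/-- The gradient of `y ↦ ⟨c, y⟩` is `c`. [folklore] -/
theorem gradient_inner_left_eq (c x : ℝ³) : gradient (fun y => ⟪c, y⟫) x = c := by
  have h : HasFDerivAt (fun y => ⟪c, y⟫) (innerSL ℝ c) x := (innerSL ℝ c).hasFDerivAt
  rw [gradient, h.fderiv]
  apply (InnerProductSpace.toDual ℝ ℝ³).injective
  rw [LinearIsometryEquiv.apply_symm_apply]
  ext y
  simp [InnerProductSpace.toDual_apply_apply]

/-- `∂ₜu = b′(t) e₀`. [folklore] -/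
theorem timeDeriv_parasiticVelocity (C : ℝ) {t : ℝ} (ht : t < 0) (x : ℝ³) :
    timeDeriv (parasiticVelocity C) t x = deriv (parasiticAmp C) t • parasiticDir := by
  simp only [timeDeriv_apply, parasiticVelocity]
  exact ((differentiableAt_parasiticAmp C ht).hasDerivAt.smul_const parasiticDir).deriv

/-- `(u·∇)u = 0`. [folklore] -/
theorem convect_parasiticVelocity (C t : ℝ) (x : ℝ³) :
    convect (parasiticVelocity C t) (parasiticVelocity C t) x = 0 := by
  show fderiv ℝ (fun _ : ℝ³ => parasiticAmp C t • parasiticDir) x (parasiticAmp C t • parasiticDir) = 0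
  simp

/-- `Δu = 0`. [folklore] -/
theorem laplacian_parasiticVelocity (C t : ℝ) (x : ℝ³) :
    Δ (parasiticVelocity C t) x = 0 := by
  show Δ (fun _ : ℝ³ => parasiticAmp C t • parasiticDir) x = 0
  rw [InnerProductSpace.laplacian_const]
  rfl

/-- `∇p = −b′(t) e₀`. [folklore] -/
theorem gradient_parasiticPressure (C t : ℝ) (x : ℝ³) :
    gradient (parasiticPressure C t) x = (-deriv (parasiticAmp C) t) • parasiticDir :=
  gradient_inner_left_eq _ x

/-- `div u = 0`. [folklore] -/
theorem isDivFree_parasiticVelocity (C t : ℝ) :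
    VectorCalculus.IsDivFree (parasiticVelocity C t) := by
  intro x
  show VectorCalculus.divergence (fun _ : ℝ³ => parasiticAmp C t • parasiticDir) x = 0
  simp [VectorCalculus.divergence]

/-- The parasitic pair solves Navier–Stokes (`ν = 1`, `f = 0`) pointwise on `t < 0`:
`∂ₜu + (u·∇)u = Δu − ∇p`. [cite: KNSS2009, §1] -/
theorem momentum_parasitic (C : ℝ) {t : ℝ} (ht : t ∈ Iio (0 : ℝ)) (x : ℝ³) :
    timeDeriv (parasiticVelocity C) t x +
        convect (parasiticVelocity C t) (parasiticVelocity C t) x =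
      (1 : ℝ) • (Δ (parasiticVelocity C t)) x - gradient (parasiticPressure C t) x +
        (0 : ℝ → ℝ³ → ℝ³) t x := by
  rw [timeDeriv_parasiticVelocity C ht x, convect_parasiticVelocity, laplacian_parasiticVelocity,
    gradient_parasiticPressure]
  simp [neg_smul]

/-- **The parasitic pair is a suitable weak solution on the backward slab** (`C²`/`C¹` classical
solutions are suitable, CKN 1982 §2, tree `isSuitableWeakSolutionOn_of_contDiffOn`).
[cite: CaffarelliKohnNirenberg1982, §2] -/
theorem parasitic_isSuitableWeakSolutionOn (C : ℝ) :
    IsSuitableWeakSolutionOn 𝕊 1 0 (parasiticVelocity C) (parasiticPressure C) :=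
  isSuitableWeakSolutionOn_of_contDiffOn (S := Iio 0) isOpen_Iio (by simp)
    (contDiffOn_parasiticVelocity C) (contDiffOn_parasiticPressure C) continuousOn_const
    (fun _ ht x => momentum_parasitic C ht x) (fun t _ => isDivFree_parasiticVelocity C t)

/-- Its weak spatial gradient (the classical one). [folklore] -/
theorem parasitic_hasWeakSpatialGradientOn (C : ℝ) :
    HasWeakSpatialGradientOn 𝕊 (parasiticVelocity C)
      (fun t x => fderiv ℝ (parasiticVelocity C t) x) :=
  hasWeakSpatialGradientOn_of_contDiffOn (S := Iio 0) isOpen_Iio (by simp)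
    (contDiffOn_parasiticVelocity C)

/-- The parasitic flow has the Type-I RATE with constant `C ≥ 0` (saturated: KNSS 2009, (1.4)).
[cite: KNSS2009, (1.4)] -/
theorem parasitic_hasTypeITimeDecay {C : ℝ} (hC : 0 ≤ C) :
    HasTypeITimeDecay C (parasiticVelocity C) :=
  fun t _ x => (norm_parasiticVelocity hC t x).le

/-- `essSup f μ = ⊤` as soon as `f` exceeds every finite level on a set of positive measure.
[folklore] -/
theorem essSup_eq_top_of_forall_exists_lt {α : Type*} {m : MeasurableSpace α} {μ : Measure α}
    {f : α → ℝ≥0∞} (h : ∀ N : ℝ≥0, ∃ S : Set α, μ S ≠ 0 ∧ ∀ x ∈ S, (N : ℝ≥0∞) < f x) :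
    essSup f μ = ⊤ := by
  by_contra hne
  obtain ⟨S, hS, hlt⟩ := h (essSup f μ).toNNReal
  have hco : ((essSup f μ).toNNReal : ℝ≥0∞) = essSup f μ := ENNReal.coe_toNNReal hne
  have hae := ENNReal.ae_le_essSup f (μ := μ)
  rw [ae_iff] at hae
  refine hS (measure_mono_null (fun x hx => ?_) hae)
  simp only [mem_setOf_eq, not_le]
  rw [← hco]
  exact hlt x hx

/-- **The parasitic flow is backward-singular at EVERY final-time point** `(0, x₀)` (`C > 0`):
`‖u‖ = C/√(−t)` exceeds every level on `(−τ, 0) × B_r(x₀)`, a set of positive measure.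
[folklore] -/
theorem parasitic_isBackwardSingularPoint {C : ℝ} (hC : 0 < C) (x₀ : ℝ³) :
    IsBackwardSingularPoint (parasiticVelocity C) ((0 : ℝ), x₀) := by
  intro r hr
  rw [eLpNorm_exponent_top]
  show essSup (fun z => ‖uncurry (parasiticVelocity C) z‖ₑ) _ = ⊤
  apply essSup_eq_top_of_forall_exists_lt
  intro N
  set K : ℝ := (N : ℝ) + 1 with hK
  have hKpos : 0 < K := by positivity
  set τ : ℝ := min (r ^ 2) ((C / K) ^ 2) / 2 with hτ
  have hmin : 0 < min (r ^ 2) ((C / K) ^ 2) := lt_min (by positivity) (by positivity)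
  have hτpos : 0 < τ := by positivity
  have hτr : τ < r ^ 2 := by
    have := min_le_left (r ^ 2) ((C / K) ^ 2)
    rw [hτ]; linarith
  have hτK : τ < (C / K) ^ 2 := by
    have := min_le_right (r ^ 2) ((C / K) ^ 2)
    rw [hτ]; linarith
  refine ⟨Ioo (-τ) 0 ×ˢ ball x₀ r, ?_, ?_⟩
  · have hsub : Ioo (-τ) 0 ×ˢ ball x₀ r ⊆ parabolicCylinder r ((0 : ℝ), x₀) := by
      rintro ⟨t, x⟩ ⟨⟨ht1, ht2⟩, hx⟩
      rw [mem_parabolicCylinder]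
      exact ⟨⟨by simp only; linarith, ht2⟩, mem_ball.1 hx⟩
    rw [Measure.restrict_apply (measurableSet_Ioo.prod measurableSet_ball),
      inter_eq_left.2 hsub, Measure.volume_eq_prod, Measure.prod_prod]
    refine mul_ne_zero ?_ (measure_ball_pos volume x₀ hr).ne'
    rw [Real.volume_Ioo]
    simp [hτpos]
  · rintro ⟨t, x⟩ ⟨⟨ht1, ht2⟩, -⟩
    simp only [uncurry_apply_pair]
    rw [← ofReal_norm, norm_parasiticVelocity hC.le,
      show ((N : ℝ≥0) : ℝ≥0∞) = ENNReal.ofReal (N : ℝ) by simp]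
    have hspos : 0 < Real.sqrt (-t) := Real.sqrt_pos.2 (by linarith)
    rw [ENNReal.ofReal_lt_ofReal_iff (div_pos hC hspos), lt_div_iff₀ hspos]
    have hst : Real.sqrt (-t) < C / K := by
      rw [Real.sqrt_lt' (div_pos hC hKpos)]
      linarith
    calc (N : ℝ) * Real.sqrt (-t) < K * Real.sqrt (-t) :=
          mul_lt_mul_of_pos_right (by rw [hK]; linarith) hspos
      _ < K * (C / K) := mul_lt_mul_of_pos_left hst hKpos
      _ = C := by field_simp

/-- In particular the parasitic flow is singular at the origin. [folklore] -/
theorem parasitic_isBackwardSingularPoint_zero {C : ℝ} (hC : 0 < C) :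
    IsBackwardSingularPoint (parasiticVelocity C) 0 :=
  parasitic_isBackwardSingularPoint hC 0

/-- The parasitic flow is in NO apex class (no space–time Type-I bound, KNSS (1.6)). [folklore] -/
theorem parasitic_not_hasTypeIDecay {C : ℝ} (hC : 0 < C) (C' : ℝ) :
    ¬ HasTypeIDecay C' (parasiticVelocity C) := by
  intro h
  set R : ℝ := |C'| / C + 1 with hR
  have hRpos : 0 < R := by positivity
  have key := h (-1) (by norm_num) (R • parasiticDir)
  rw [norm_parasiticVelocity hC.le, norm_smul, norm_parasiticDir, mul_one, Real.norm_of_nonneg hRpos.le,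
    neg_neg, Real.sqrt_one, div_one, le_div_iff₀ (by positivity)] at key
  have : C * (R + 1) = |C'| + 2 * C := by
    rw [hR]; field_simp; ring
  linarith [le_abs_self C']

/-- The parasitic flow is exactly backward self-similar: `u_λ = u` for every `λ > 0`. [folklore] -/
theorem parasitic_nsRescale (C : ℝ) {lam : ℝ} (hlam : 0 < lam) :
    nsRescale lam (parasiticVelocity C) = parasiticVelocity C := by
  funext t x
  show lam • (parasiticAmp C (lam ^ 2 * t) • parasiticDir) = parasiticAmp C t • parasiticDir
  rw [smul_smul]
  congr 1
  simp only [parasiticAmp]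
  rw [show -(lam ^ 2 * t) = lam ^ 2 * (-t) by ring, Real.sqrt_mul (sq_nonneg _),
    Real.sqrt_sq hlam.le]
  by_cases hs : Real.sqrt (-t) = 0
  · simp [hs]
  · field_simp

/-- ... and invariant under spatial translations. [folklore] -/
theorem parasitic_translate (C : ℝ) (a : ℝ³) :
    (fun t x => parasiticVelocity C t (x + a)) = parasiticVelocity C := rfl

/-! ## `𝐈 = ∞` for the parasitic flow -/

/-- Slice energy in a ball: `∫_{B_r(x₀)} |u(t)|² = |b_C(t)|² |B_r|`. [folklore] -/
theorem lintegral_ball_parasitic (C t r : ℝ) (x₀ : ℝ³) :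
    ∫⁻ x in ball x₀ r, ‖parasiticVelocity C t x‖ₑ ^ 2 = ‖parasiticAmp C t‖ₑ ^ 2 * volume (ball x₀ r) := by
  show ∫⁻ _ in ball x₀ r, ‖parasiticAmp C t • parasiticDir‖ₑ ^ 2 = _
  rw [setLIntegral_const, enorm_smul, enorm_parasiticDir, mul_one]

/-- **`A(Q(0, r)) = ∞`** for the parasitic flow (Albritton–Barker's scaled energy at the apex):
`r⁻¹ |B_r| C²/(−t)` exceeds every level for `t` near `0⁻`. [cite: AlbrittonBarker2019, §1] -/
theorem parasitic_cknAEss_eq_top {C : ℝ} (hC : 0 < C) {r : ℝ} (hr : 0 < r) :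
    cknAEss r (0 : ℝ × ℝ³) (parasiticVelocity C) = ⊤ := by
  unfold cknAEss
  simp_rw [lintegral_ball_parasitic]
  simp only [Prod.fst_zero, Prod.snd_zero, zero_sub]
  set V : ℝ≥0∞ := volume (ball (0 : ℝ³) r) with hV
  have hV0 : V ≠ 0 := (measure_ball_pos volume (0 : ℝ³) hr).ne'
  have hVtop : V ≠ ⊤ := measure_ball_lt_top.ne
  set Kinf : ℝ≥0∞ := (ENNReal.ofReal r)⁻¹ * V with hKinf
  have hK0 : Kinf ≠ 0 := mul_ne_zero (ENNReal.inv_ne_zero.2 ENNReal.ofReal_ne_top) hV0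
  have hKtop : Kinf ≠ ⊤ :=
    ENNReal.mul_ne_top (ENNReal.inv_ne_top.2 (by simpa using hr)) hVtop
  set k : ℝ := Kinf.toReal with hk
  have hkpos : 0 < k := ENNReal.toReal_pos hK0 hKtop
  apply essSup_eq_top_of_forall_exists_lt
  intro N
  set M : ℝ := (N : ℝ) + 1 with hM
  have hMpos : 0 < M := by positivity
  set τ : ℝ := min (r ^ 2) (k * C ^ 2 / M) / 2 with hτ
  have hmin : 0 < min (r ^ 2) (k * C ^ 2 / M) := lt_min (by positivity) (by positivity)
  have hτpos : 0 < τ := by positivity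
  have hτr : τ < r ^ 2 := by
    have := min_le_left (r ^ 2) (k * C ^ 2 / M)
    rw [hτ]; linarith
  have hτM : τ < k * C ^ 2 / M := by
    have := min_le_right (r ^ 2) (k * C ^ 2 / M)
    rw [hτ]; linarith
  refine ⟨Ioo (-τ) 0, ?_, ?_⟩
  · rw [Measure.restrict_apply measurableSet_Ioo,
      inter_eq_left.2 (Ioo_subset_Ioo (by linarith) le_rfl), Real.volume_Ioo]
    simp [hτpos]
  · intro t ⟨ht1, ht2⟩
    have hnt : 0 < -t := by linarith
    have hamp : ‖parasiticAmp C t‖ₑ ^ 2 = ENNReal.ofReal (C ^ 2 / (-t)) := by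
      rw [← ofReal_norm, Real.norm_eq_abs, ← ENNReal.ofReal_pow (abs_nonneg _), sq_abs]
      congr 1
      simp only [parasiticAmp]
      rw [div_pow, Real.sq_sqrt hnt.le]
    rw [hamp, mul_comm (ENNReal.ofReal _) V, ← mul_assoc, ← hKinf,
      ← ENNReal.ofReal_toReal hKtop, ← hk, ← ENNReal.ofReal_mul hkpos.le,
      show ((N : ℝ≥0) : ℝ≥0∞) = ENNReal.ofReal (N : ℝ) by simp,
      ENNReal.ofReal_lt_ofReal_iff (by positivity), mul_div_assoc', lt_div_iff₀ hnt]
    calc (N : ℝ) * -t ≤ M * -t := by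
          apply mul_le_mul_of_nonneg_right _ hnt.le
          rw [hM]; linarith
      _ < M * (k * C ^ 2 / M) := mul_lt_mul_of_pos_left (by linarith) hMpos
      _ = k * C ^ 2 := by field_simp

/-- **`𝐈 = ∞` for the parasitic flow**, for EVERY pressure and EVERY gradient candidate: it
violates exactly one antecedent hypothesis of the crux, `typeIBound < ⊤` (KNSS 2009 §1 /
Albritton–Barker 2019 §1: "`v ≡ const.` and `𝐈 < ∞` imply `v ≡ 0`"). [cite: AlbrittonBarker2019, §1] -/
theorem parasitic_typeIBound_eq_top {C : ℝ} (hC : 0 < C) (p : ℝ → ℝ³ → ℝ)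
    (G : ℝ → ℝ³ → ℝ³ →L[ℝ] ℝ³) :
    typeIBound (Iio (0 : ℝ) ×ˢ univ) (parasiticVelocity C) p G = ⊤ := by
  refine eq_top_iff.2 ?_
  have hsub : parabolicCylinder 1 (0 : ℝ × ℝ³) ⊆ Iio (0 : ℝ) ×ˢ univ := by
    rintro ⟨t, x⟩ h
    rw [mem_parabolicCylinder] at h
    exact ⟨by simpa using h.1.2, mem_univ _⟩
  calc (⊤ : ℝ≥0∞) = cknAEss 1 (0 : ℝ × ℝ³) (parasiticVelocity C) :=
        (parasitic_cknAEss_eq_top hC one_pos).symm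
    _ ≤ abScaledSum 1 0 (parasiticVelocity C) p G := by
        unfold abScaledSum
        exact le_self_add.trans (le_self_add.trans le_self_add)
    _ ≤ typeIBound (Iio (0 : ℝ) ×ˢ univ) (parasiticVelocity C) p G :=
        abScaledSum_le_typeIBound one_pos hsub

/-! ## The gap between the two classes; a refuted strengthening -/

/-- A space–time Type-I bound forces `0 ≤ C` (evaluate at `t = -1`, `x = 0`). [folklore] -/
theorem nonneg_of_hasTypeIDecay {C : ℝ} {u : ℝ → ℝ³ → ℝ³} (h : HasTypeIDecay C u) : 0 ≤ C := by
  have := h (-1) (by norm_num) 0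
  rw [norm_zero, zero_add, neg_neg, Real.sqrt_one, div_one] at this
  exact (norm_nonneg _).trans this

/-- **Apex profiles have no final-time singular point off the origin**: the space–time bound
`‖u‖ ≤ C/(‖x‖ + √(−t))` bounds `u` by `2C/‖x₀‖` on `Q((0, x₀), ‖x₀‖/2)`. Contrast
`parasitic_isBackwardSingularPoint`: under the mere rate every `(0, x₀)` may be singular — the
crux is an isolation statement for the final-time singular set. [folklore] -/
theorem not_isBackwardSingularPoint_of_hasTypeIDecay {C : ℝ} {u : ℝ → ℝ³ → ℝ³}
    (h : HasTypeIDecay C u) {x₀ : ℝ³} (hx : x₀ ≠ 0) :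
    ¬ IsBackwardSingularPoint u ((0 : ℝ), x₀) := by
  intro hs
  have hC : 0 ≤ C := nonneg_of_hasTypeIDecay h
  set r : ℝ := ‖x₀‖ / 2 with hr
  have hx0 : 0 < ‖x₀‖ := norm_pos_iff.2 hx
  have hrpos : 0 < r := by positivity
  have hbound : ∀ z ∈ parabolicCylinder r ((0 : ℝ), x₀), ‖uncurry u z‖ ≤ C / r := by
    rintro ⟨t, x⟩ hz
    rw [mem_parabolicCylinder] at hz
    obtain ⟨⟨-, ht2⟩, hdist⟩ := hz
    have ht : t < 0 := by simpa using ht2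
    have hxr : r ≤ ‖x‖ := by
      have hd : ‖x - x₀‖ < r := by rwa [← dist_eq_norm]
      have h1 : ‖x₀‖ ≤ ‖x‖ + ‖x - x₀‖ := by
        calc ‖x₀‖ = ‖x - (x - x₀)‖ := by rw [sub_sub_cancel]
          _ ≤ ‖x‖ + ‖x - x₀‖ := norm_sub_le _ _
      linarith
    calc ‖u t x‖ ≤ C / (‖x‖ + Real.sqrt (-t)) := h t ht x
      _ ≤ C / r := div_le_div_of_nonneg_left hC hrpos (by linarith [Real.sqrt_nonneg (-t)])
  have hlt : eLpNorm (uncurry u) ∞ (volume.restrict (parabolicCylinder r ((0 : ℝ), x₀))) < ⊤ := by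
    rw [eLpNorm_exponent_top]
    exact eLpNormEssSup_lt_top_of_ae_bound
      (ae_restrict_of_forall_mem (isOpen_parabolicCylinder r _).measurableSet hbound)
  exact hlt.ne (hs r hrpos)

/-- **Refuted strengthening** ("the given profile is already apex", without `𝐈`): it is FALSE that
every suitable weak solution on the slab with a weak gradient, the Type-I rate and a singular
origin admits a space–time Type-I bound — the parasitic flow is a counterexample, and since its
whole symmetry orbit is itself (`parasitic_nsRescale`, `parasitic_translate`), even "some
translate / zoom / limit of it is apex" fails. With `𝐈 < ⊤` added this strengthening implies
the crux and is as open as the crux. [folklore] -/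
theorem not_rate_imp_spaceTime_of_suitable_singular :
    ¬ ∀ (C : ℝ) (u : ℝ → ℝ³ → ℝ³) (p : ℝ → ℝ³ → ℝ) (G : ℝ → ℝ³ → ℝ³ →L[ℝ] ℝ³),
        IsSuitableWeakSolutionOn 𝕊 1 0 u p → HasWeakSpatialGradientOn 𝕊 u G →
          HasTypeITimeDecay C u → IsBackwardSingularPoint u 0 → ∃ C' : ℝ, HasTypeIDecay C' u := by
  intro h
  obtain ⟨C', hC'⟩ := h 1 _ _ _ (parasitic_isSuitableWeakSolutionOn 1)
    (parasitic_hasWeakSpatialGradientOn 1) (parasitic_hasTypeITimeDecay zero_le_one)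
    (parasitic_isBackwardSingularPoint_zero one_pos)
  exact parasitic_not_hasTypeIDecay one_pos C' hC'

end Literature.Analysis.FluidPDE
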